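import Mathlib

/-!
# A non-zero binary form does not vanish at some lattice point of slope `< 1/2`

Stub `stub_lowestFormNonvanishing` of the line `lambda-layer-one` of the crux `EdgeDecay`
(`Summit.BirchSwinnertonDyer.BirchSwinnertonDyer.Theses.TangentCone.EdgeDecay`).

Elementary algebra (generic-slope step). If `G 0, …, G d : ℚ_[p]` are not all zero, put
`b := 2 d + 3`. The polynomial `P(T) = ∑_{j ≤ d} G j · b^{d-j} · T^j ∈ ℚ_[p][T]` has the non-zero
coefficient `G j₀ · b^{d-j₀}` at `T^{j₀}`, so `P ≠ 0`, and `natDegree P ≤ d`; hence `P` cannot vanish at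
all of the `d + 1` distinct points `T = 0, 1, …, d` (`ℚ_[p]` is a domain of characteristic zero).
Any such `a ≤ d` satisfies `2 a < b`, and `P(a) = ∑_{j ≤ d} G j · b^{d-j} · a^j`.
-/

set_option linter.dupNamespace false

namespace Summit.BirchSwinnertonDyer.BirchSwinnertonDyer.Theorems

open Polynomial in
/-- If `G 0, …, G d` are not all zero in a characteristic-zero domain `R` and `b ≠ 0`, then
`∑_{j ≤ d} G j · b^{d-j} · a^j ≠ 0` for some natural number `a ≤ d`: a non-zero polynomial of
degree `≤ d` does not vanish at all of `0, 1, …, d`. [folklore] -/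
private theorem lowestForm_exists_nat_le_sum_ne_zero {R : Type*} [CommRing R] [IsDomain R]
    [CharZero R] (G : ℕ → R) (d : ℕ) {b : R} (hb : b ≠ 0) (hG : ∃ j : ℕ, j ≤ d ∧ G j ≠ 0) :
    ∃ a : ℕ, a ≤ d ∧ ∑ j ∈ Finset.range (d + 1), G j * b ^ (d - j) * (a : R) ^ j ≠ 0 := by
  obtain ⟨j₀, hj₀, hG₀⟩ := hG
  -- the one-variable polynomial `P(T) = ∑_{j ≤ d} G j · b^{d-j} · T^j`
  let P : R[X] := ∑ j ∈ Finset.range (d + 1), C (G j * b ^ (d - j)) * X ^ j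
  have hPcoeff : P.coeff j₀ = G j₀ * b ^ (d - j₀) := by
    simp only [P, finsetSum_coeff, coeff_C_mul_X_pow, Finset.sum_ite_eq, Finset.mem_range]
    rw [if_pos (Nat.lt_succ_of_le hj₀)]
  have hPne : P ≠ 0 := fun h =>
    mul_ne_zero hG₀ (pow_ne_zero _ hb) (by rw [← hPcoeff, h, coeff_zero])
  have hPdeg : P.natDegree ≤ d :=
    natDegree_sum_le_of_forall_le _ _ fun j hj =>
      (natDegree_C_mul_X_pow_le _ _).trans (Nat.le_of_lt_succ (Finset.mem_range.mp hj))
  -- `P` cannot vanish at the `d + 1` distinct points `0, 1, …, d`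
  have hex : ∃ i : Fin (d + 1), P.eval ((i : ℕ) : R) ≠ 0 := by
    by_contra hall
    push Not at hall
    refine hPne (eq_zero_of_natDegree_lt_card_of_eval_eq_zero P
      (f := fun i : Fin (d + 1) => ((i : ℕ) : R)) (Nat.cast_injective.comp Fin.val_injective)
      hall ?_)
    rw [Fintype.card_fin]
    exact Nat.lt_succ_of_le hPdeg
  obtain ⟨i, hi⟩ := hex
  refine ⟨i, Nat.le_of_lt_succ i.2, ?_⟩
  simpa only [P, eval_finsetSum, eval_mul, eval_C, eval_pow, eval_X] using hi

/-- **Generic-slope step** (elementary algebra): if the coefficients `G 0, …, G d` of a binary form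
`F_d(X, Y) = ∑_{j ≤ d} G j X^{d-j} Y^j` over `ℚ_[p]` are not all zero, then the form does not vanish at
some lattice point `(X, Y) = (b, a)` with `0 < b` and `2 a < b` (slope `a / b < 1/2`); one may take
`b = 2 d + 3` and some `a ≤ d`. [folklore] -/
theorem stub_lowestFormNonvanishing :
    ∀ (p : ℕ) [Fact p.Prime] (G : ℕ → ℚ_[p]) (d : ℕ), (∃ j : ℕ, j ≤ d ∧ G j ≠ 0) → ∃ a b : ℕ, 0 < b ∧ 2 * a < b ∧ ∑ j ∈ Finset.range (d + 1), G j * (b : ℚ_[p]) ^ (d - j) * (a : ℚ_[p]) ^ j ≠ 0 := by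
  intro p _ G d hG
  have hb : ((2 * d + 3 : ℕ) : ℚ_[p]) ≠ 0 := Nat.cast_ne_zero.mpr (by omega)
  obtain ⟨a, had, ha⟩ := lowestForm_exists_nat_le_sum_ne_zero G d hb hG
  exact ⟨a, 2 * d + 3, by omega, by omega, ha⟩

end Summit.BirchSwinnertonDyer.BirchSwinnertonDyer.Theorems
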